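import Summits.QuantumFields.YangMills.Theorems.IsotropyFromPowerCountingTemperedCurvatureMomentsOfShieldedMomentBound
import Summits.QuantumFields.YangMills.Theorems.IsotropyFromPowerCountingTemperedCurvatureMomentsShieldedSubseqTame
import Summits.QuantumFields.YangMills.Theorems.IsotropyFromPowerCountingTemperedCurvatureMomentsShieldedSubseqZeroCoupling
import Summits.QuantumFields.YangMills.Theorems.IsotropyFromPowerCountingTemperedCurvatureMomentsApproximantsTransfer
import Summits.QuantumFields.YangMills.Theorems.IsotropyFromPowerCountingTemperedCurvatureMomentsDominated
import Summits.QuantumFields.YangMills.Theorems.IsotropyFromPowerCountingTemperedCurvatureMomentsDegreeTwo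
import Summits.QuantumFields.YangMills.Theorems.IsotropyFromPowerCountingTemperedCurvatureMomentsBddRenormalisationOrderZero
import Literature.MathematicalPhysics.QuantumLattice.TorusWilsonMarkov

/-!
# Crux `TemperedCurvatureMoments` (T, stmt-QuantumFields-17721) — line `Sketch`, lead skeleton (reshape 4, lead c3)

Registered skeleton of the line lead.  Reshape 1 (lead c0) landed A1–A3, C1–C3 and the composition
`temperedApproximants_of_shieldedMomentBound` (p146599); reshape 2 (lead c1) landed A4 `stub_approximantsTransfer`
(p164918) and made the heart subsequential; reshape 3 (lead c2) landed degree 2 model-blind (`stub_degreeTwo`, p168473)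
and left ONE stub, CH_n along a subsequence for `n ≥ 3`.  Every `stub_*` below is a SIGNATURE (sorried) stated over TREE
objects only; `TemperedCurvatureMoments_of` composes them and concludes the crux BY NAME, by cases on the degree.

Reshape 4 splits the residual BY DEGREE once more:

* degree `n = 1`: LANDED (`DegreeOne.temperedCurvatureMoments_one`, p140708).
* degree `n = 2`: LANDED (`stub_degreeTwo`, p168473).
* degree `n = 3` (NEW): model-blind analysis GIVEN diagonal product-tensor reflection positivity of `S₁`.
  Lead c3's triage of card `Ideas/soft-degree-three.md`: (a) its stub 1 (extended AXIS RP "free from the lattice") is not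
  derivable through the single-species tie — the curvature species is the FORWARD plaquette star, fixed by no axis
  reflection (also `Cruxes/SoftKernelBoostCovariance/ERP-not-free-c16.md`); (b) under the honest hypotheses of T
  (time-ordered RP in sixteen frames, axis cones, diagonal in-plane cones) the tie-class span criterion is DEFICIENT in
  degree 3 (L-configurations, e.g. `(0, e₃, e₀)`: rank 8/12); (c) the forward star IS exactly covariant under the diagonal
  swaps `x_i ↔ x_j` (landed `CurvatureKernel.CurvatureSwapCovariance`), so DIAGONAL product-tensor RP of the limit is the
  lattice-natural input — same mechanism and same open step (no diagonal mirror on the torus; free-box RP + torus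
  comparison) as crux D `DiagonalMirrorRPR` — and WITH it the span criterion holds at every pairwise-distinct triple with
  two fully controlled slots (exact check on 10⁴ triples; proof in the crux NOTES), while degree 4 stays deficient at
  rectangles (junk family, p141448).  Stubs:
  - `stub_diagonalProductRP` (OPEN, crux-D type): `W1` ⇒ product-tensor RP of `S₁` across the four oriented diagonal
    mirrors of the `(x₀,x₁)`-plane (pull-back form, verbatim the shape of `IsReflectionPositive` with "time-ordered"
    replaced by "complex product tensor with pairwise-disjoint compact factor supports in `{x⁰ > 0}`").
  - `stub_threePointChartBounds` (QFT → analysis): for every oriented lattice frame `(n, v)` (axis time `n = ±e_μ` with any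
    other axis `v`, or diagonal time `n = (±e_μ ± e_ν)/√2` with its in-plane partner `v`), mirror level `c`, gap `δ`:
    `|𝔖₃(f₁ ⊗ f₂ ⊗ ∂_wᴺ g)| ≤ C δ⁻ᵖ |f₁|_{M₀}|f₂|_{M₀}|g|_{M₀}` for `w ∈ {n, v}`, the pair `f₁, f₂` below the mirror and
    `n`-ORDERED (time-ordered RP), `g` beyond the gap; and, given diagonal product RP, the same for a merely DISJOINT pair in
    diagonal frames.  Mechanism: Gram/Cauchy–Schwarz for the 2×2 reflection-positive matrix of `{pair, ∂ᴺg}`, E0′ for the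
    pair norm, and Cauchy estimates on the planar-cone analytic function `Φ(t,b) = 𝔖₂(θg* ⊗ T_{te₀+be₁} g)` (PlanarCone;
    in diagonal frames from `PlanarSpectralCone_of` applied to the 45°-rotated family, whose eight planar frames are the
    same eight; axis frames by `Hypercubic`); no operator theory.
  - `stub_threeSlotRegularity` (pure analysis): a translation-invariant functional on `𝓢((ℝ⁴)³)` with pure-derivative slot
    bounds of fixed Schwartz order along lattice directions whose slot vectors together with the diagonal translations span
    `ℝ¹²` is, near the configuration, integration against a continuous kernel with an EXPLICIT bound
    `B₀ ρ^{-q} (1+‖x‖)^q` (Fourier decay: `PlaneWaveTensorDecay`-type slot estimates + the translation identity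
    `Λ(∂_Uᴺ ψ) = 0`, `FourierDecayKernel` on the flattened space).
  - `stub_chartSelection` (pure geometry): for every injective triple two slots are GOOD with gaps `≥ c·r_min` — good =
    isolated above an `e_μ`-separated pair in an axis frame (cone ⇒ all of `ℝ⁴`), or isolated in diagonal frames whose time /
    partner directions span `ℝ⁴` (case analysis on the coordinate tie types B/C/D/Z, ladder pigeonhole for the scale).
  - `stub_threePointKernel` (assembly, takes the three statements above as hypotheses): a continuous kernel `K₃` on the
    injective locus with `|K₃(y)| ≤ C (1+‖y‖)ᴺ (1 + Σ_{i≠j} ‖yᵢ−yⱼ‖⁻¹)ᴺ` representing `𝔖₃` on compactly supported test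
    functions supported there (local kernels at radius `ρ = c r_min/8`, uniqueness on overlaps, partition of unity).
  - `stub_degreeThreeOfKernel` (pure analysis + landed `temperedApproximants_of_dominated`): such a kernel + realness ⇒
    `TemperedApproximants a L S₁ 3` along every admissible `(a, L)` (⁰𝒮₃-extension by three-diagonal cut-offs, domination).
* degrees `n ≥ 4`: `stub_shieldedMomentBoundSubseqFour` = reshape 3's stub with `3 ≤ n` replaced by `4 ≤ n` (the
  Yang–Mills UV content; certified on the frequently-tame sector p163367/p163950; open for eventually-wild schemes).
* Composition: `n = 1, 2` landed; `n = 3`: kernel ⇒ domination ⇒ approximants; `n ≥ 4`: CH along a subsequence ⇒ reindexed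
  scheme (`tie_reindex`) ⇒ `temperedApproximants_of_shieldedMomentBound` ⇒ A4 transfer; `temperedCurvatureMoments_iff`.

References: Osterwalder–Schrader 1973 §2, §4 (E2, `e^{-tH}` estimates), 1975 §4; Glimm–Jaffe 1987 §6.1, Thm. 6.1.3,
Cor. 19.5.6; Hörmander ALPDO I §8.1 (wave-front criterion for functions); Fröhlich–Israel–Lieb–Simon 1978 Thm. 2.1 and
Osterwalder–Seiler 1978 §2 (diagonal site-mirror RP of Wilson's action).
-/

noncomputable section

-- tree-known workaround (cf. the imported support file)
attribute [-instance] SimplexCategory.instFintypeToTypeOrderHomFinHAddNatLenOfNat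

namespace Summit.QuantumFields.YangMills.Theorems.TemperedCurvatureMoments.Sketch

open scoped BigOperators SchwartzMap ENNReal
open MeasureTheory Filter Topology ProbabilityTheory
open Literature.MathematicalPhysics.QuantumFieldTheory Literature.MathematicalPhysics.QuantumLattice
open Literature.MathematicalPhysics.AQFT
open Literature.Probability.LatticeModels (box Site)
open Summit.QuantumFields.YangMills.Theorems.OSLegsFromFemtoAndGap (torusMoment)
open Summit.QuantumFields.YangMills.Theorems.CurvatureBoostCovariance.Negative
  (Tie W1 OSPackage Translations Hypercubic EightFrameRP PlanarCone)
open Summit.QuantumFields.YangMills.Theorems.NPointIsotropy.Negative (E4)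
open Summit.QuantumFields.YangMills.Theses.IsotropyFromPowerCounting (TemperedCurvatureMoments)
open Summit.QuantumFields.YangMills.Theorems.TemperedCurvatureMoments.Negative
  (TemperedApproximants temperedCurvatureMoments_iff)
open Summit.QuantumFields.YangMills.Theorems.SoftKernelBoostCovariance.Sketch (DegreeOne.temperedCurvatureMoments_one)

variable {G : Type} [Group G] [TopologicalSpace G] [IsTopologicalGroup G] [CompactSpace G]
  [MeasurableSpace G] [BorelSpace G]

/-! ## Degree 3, input: diagonal product-tensor reflection positivity (OPEN, crux-D mechanism) -/

/-- **Stub A `stub_diagonalProductRP` (OPEN; the lattice input of degree 3).**  For every admissible `(G, r, sch, S₁)`: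
reflection positivity of `S₁`, in pull-back form across each of the four oriented diagonal mirrors `x₀ = ±x₁`
(`R e₀ = a e₀ + b e₁`, `a² = b² = 1/2`), on finite families of COMPLEX PRODUCT TENSORS whose factors have pairwise-disjoint
compact supports in the open positive half-space (no time-ordering): `Σᵢⱼ 𝔖(θFᵢ* ⊗ Fⱼ) ≥ 0`.  Lattice mechanism: the
forward plaquette star is exactly covariant under the site swap `x₀ ↔ x₁` (`CurvatureSwapCovariance`), Wilson's free-box
measure is swap-reflection positive (`SwapReflectionPositivity`, FILS 1978 Thm. 2.1), equicontinuity of the tied moment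
functionals; OPEN step: torus ↔ free box at physical scale from the uniform lattice gap (the step crux D also needs). -/
theorem stub_diagonalProductRP :
    ∀ (G : Type) [Group G] [TopologicalSpace G] [IsTopologicalGroup G] [CompactSpace G]
      [MeasurableSpace G] [BorelSpace G], IsCompactSimpleLieGroup G →
      ∀ (r : LatticeRep G) (sch : SpeciesScheme (YMSpecies G)) (S₁ : SchwingerFamily E4),
        W1 r sch S₁ → EightFrameRP S₁ → PlanarCone S₁ →
        (∀ (R : E4 ≃ₗᵢ[ℝ] E4) (a b : ℝ), a ^ 2 = 1 / 2 → b ^ 2 = 1 / 2 →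
        R (EuclideanSpace.single (0 : Fin 4) (1 : ℝ)) = a • EuclideanSpace.single (0 : Fin 4) (1 : ℝ) + b • EuclideanSpace.single (1 : Fin 4) (1 : ℝ) →
        (∀ (N : ℕ) (deg : Fin N → ℕ) (g : (j : Fin N) → Fin (deg j) → 𝓢(E4, ℂ))
          (F : (j : Fin N) → 𝓢((Fin (deg j) → E4), ℂ)),
          (∀ j, IsTensorOf (F j) (g j)) →
          (∀ j i, HasCompactSupport (g j i : E4 → ℂ) ∧ tsupport (g j i : E4 → ℂ) ⊆ {x : E4 | 0 < x 0}) →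
          (∀ j i i', i ≠ i' → Disjoint (tsupport (g j i : E4 → ℂ)) (tsupport (g j i' : E4 → ℂ))) →
          ∀ H : (i j : Fin N) → 𝓢((Fin (deg i + deg j) → E4), ℂ),
            (∀ i j, IsAppendTensorOf (H i j) (osAdjoint (F i)) (F j)) →
              0 ≤ (∑ i, ∑ j, (fun m => (S₁ m).comp (linActMulti R)) (deg i + deg j) (H i j)).re ∧ (∑ i, ∑ j, (fun m => (S₁ m).comp (linActMulti R)) (deg i + deg j) (H i j)).im = 0)) := by
  sorry

/-! ## Degree 3, model-blind analysis -/

/-- **Stub B `stub_threePointChartBounds` (QFT → analysis interface of degree 3).**  For a one-species family with the OS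
package, translations, proper signed permutations, the eight planar frames and the planar cone: ONE Schwartz order `M₀` and,
for every derivative order `N`, constants `C, p` (uniform over the finite frame menu) such that for every oriented lattice
frame — axis time `n = ±e_μ` with another axis `v = ±e_ν`, or diagonal time `n = (±e_μ ± e_ν)/√2` with in-plane partner
`v = (±e_μ ∓ e_ν)/√2` — every mirror level `c`, gap `δ ∈ (0,1]`, compactly supported `f₁, f₂` below the mirror forming an
`n`-ORDERED pair, `g` beyond the gap, and `w ∈ {n, v}`:  `‖𝔖₃(f₁ ⊗ f₂ ⊗ ∂_wᴺ g)‖ ≤ C δ⁻ᵖ |f₁|_{M₀} |f₂|_{M₀} |g|_{M₀}`;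
and, GIVEN diagonal product RP (stub A's conclusion as hypothesis), the same in the diagonal frames for a merely DISJOINT
pair.  Proof: 2×2 Gram positivity of `{θ-side pair tensor, ∂_wᴺ g}` (time-ordered E2, resp. product RP) ⇒
`|𝔖₃|² ≤ 𝔖₄(pair) · 𝔖₂(θ(∂ᴺg)* ⊗ T ∂ᴺg)`; E0′ for the pair; integration by parts along the joint `w`-translation and
Cauchy estimates for `Φ(t,b) = 𝔖₂(θg₀* ⊗ T_{te₀+be₁} g₀)` on the cone domain `|Im b| < Re t` (PlanarCone of the pulled-back
family: axis frames by `Hypercubic`, diagonal frames by `PlanarSpectralCone_of` on the 45°-rotated family, whose eight planar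
frames are the original eight); frame change as in `ChartDerivativeBoundsFrame`; slot swap by E3. -/
theorem stub_threePointChartBounds :
    ∀ (S₁ : SchwingerFamily E4), OSPackage S₁ → Translations S₁ → Hypercubic S₁ → EightFrameRP S₁ → PlanarCone S₁ →
      (∃ M₀ : ℕ, ∀ N : ℕ, ∃ (C : ℝ) (p : ℕ), ∀ (n v : E4),
          ((∃ (μ ν : Fin 4) (s s' : ℝ), μ ≠ ν ∧ (s = 1 ∨ s = -1) ∧ (s' = 1 ∨ s' = -1) ∧
            n = s • (EuclideanSpace.single μ (1 : ℝ) : E4) ∧ v = s' • (EuclideanSpace.single ν (1 : ℝ) : E4)) ∨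
          (∃ (μ ν : Fin 4) (s s' : ℝ), μ ≠ ν ∧ (s = 1 ∨ s = -1) ∧ (s' = 1 ∨ s' = -1) ∧
            n = (Real.sqrt 2)⁻¹ • (s • (EuclideanSpace.single μ (1 : ℝ) : E4) + s' • (EuclideanSpace.single ν (1 : ℝ) : E4)) ∧
            v = (Real.sqrt 2)⁻¹ • (s • (EuclideanSpace.single μ (1 : ℝ) : E4) - s' • (EuclideanSpace.single ν (1 : ℝ) : E4)))) →
          ∀ δ : ℝ, 0 < δ → δ ≤ 1 → ∀ (c : ℝ) (f₁ f₂ g : 𝓢(E4, ℂ)),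
            HasCompactSupport (f₁ : E4 → ℂ) → HasCompactSupport (f₂ : E4 → ℂ) → HasCompactSupport (g : E4 → ℂ) →
            tsupport (f₁ : E4 → ℂ) ⊆ {x : E4 | inner ℝ x n < c} → tsupport (f₂ : E4 → ℂ) ⊆ {x : E4 | inner ℝ x n < c} →
            tsupport (g : E4 → ℂ) ⊆ {x : E4 | c + δ < inner ℝ x n} →
            (∃ c' : ℝ, (tsupport (f₁ : E4 → ℂ) ⊆ {x : E4 | inner ℝ x n < c'} ∧ tsupport (f₂ : E4 → ℂ) ⊆ {x : E4 | c' < inner ℝ x n}) ∨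
              (tsupport (f₂ : E4 → ℂ) ⊆ {x : E4 | inner ℝ x n < c'} ∧ tsupport (f₁ : E4 → ℂ) ⊆ {x : E4 | c' < inner ℝ x n})) →
            ∀ w : E4, (w = n ∨ w = v) → ∀ F : 𝓢((Fin 3 → E4), ℂ),
              IsTensorOf F ![f₁, f₂, ((LineDeriv.lineDerivOp w : 𝓢(E4, ℂ) → 𝓢(E4, ℂ))^[N] g)] →
                ‖S₁ 3 F‖ ≤ C * (1 / δ) ^ p * schwartzNorm M₀ f₁ * schwartzNorm M₀ f₂ * schwartzNorm M₀ g) ∧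
      ((∀ (R : E4 ≃ₗᵢ[ℝ] E4) (a b : ℝ), a ^ 2 = 1 / 2 → b ^ 2 = 1 / 2 →
        R (EuclideanSpace.single (0 : Fin 4) (1 : ℝ)) = a • EuclideanSpace.single (0 : Fin 4) (1 : ℝ) + b • EuclideanSpace.single (1 : Fin 4) (1 : ℝ) →
        (∀ (N : ℕ) (deg : Fin N → ℕ) (g : (j : Fin N) → Fin (deg j) → 𝓢(E4, ℂ))
          (F : (j : Fin N) → 𝓢((Fin (deg j) → E4), ℂ)),
          (∀ j, IsTensorOf (F j) (g j)) →
          (∀ j i, HasCompactSupport (g j i : E4 → ℂ) ∧ tsupport (g j i : E4 → ℂ) ⊆ {x : E4 | 0 < x 0}) →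
          (∀ j i i', i ≠ i' → Disjoint (tsupport (g j i : E4 → ℂ)) (tsupport (g j i' : E4 → ℂ))) →
          ∀ H : (i j : Fin N) → 𝓢((Fin (deg i + deg j) → E4), ℂ),
            (∀ i j, IsAppendTensorOf (H i j) (osAdjoint (F i)) (F j)) →
              0 ≤ (∑ i, ∑ j, (fun m => (S₁ m).comp (linActMulti R)) (deg i + deg j) (H i j)).re ∧ (∑ i, ∑ j, (fun m => (S₁ m).comp (linActMulti R)) (deg i + deg j) (H i j)).im = 0)) →
        ∃ M₀ : ℕ, ∀ N : ℕ, ∃ (C : ℝ) (p : ℕ), ∀ (n v : E4),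
          (∃ (μ ν : Fin 4) (s s' : ℝ), μ ≠ ν ∧ (s = 1 ∨ s = -1) ∧ (s' = 1 ∨ s' = -1) ∧
            n = (Real.sqrt 2)⁻¹ • (s • (EuclideanSpace.single μ (1 : ℝ) : E4) + s' • (EuclideanSpace.single ν (1 : ℝ) : E4)) ∧
            v = (Real.sqrt 2)⁻¹ • (s • (EuclideanSpace.single μ (1 : ℝ) : E4) - s' • (EuclideanSpace.single ν (1 : ℝ) : E4))) →
          ∀ δ : ℝ, 0 < δ → δ ≤ 1 → ∀ (c : ℝ) (f₁ f₂ g : 𝓢(E4, ℂ)),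
            HasCompactSupport (f₁ : E4 → ℂ) → HasCompactSupport (f₂ : E4 → ℂ) → HasCompactSupport (g : E4 → ℂ) →
            tsupport (f₁ : E4 → ℂ) ⊆ {x : E4 | inner ℝ x n < c} → tsupport (f₂ : E4 → ℂ) ⊆ {x : E4 | inner ℝ x n < c} →
            tsupport (g : E4 → ℂ) ⊆ {x : E4 | c + δ < inner ℝ x n} →
            Disjoint (tsupport (f₁ : E4 → ℂ)) (tsupport (f₂ : E4 → ℂ)) →
            ∀ w : E4, (w = n ∨ w = v) → ∀ F : 𝓢((Fin 3 → E4), ℂ),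
              IsTensorOf F ![f₁, f₂, ((LineDeriv.lineDerivOp w : 𝓢(E4, ℂ) → 𝓢(E4, ℂ))^[N] g)] →
                ‖S₁ 3 F‖ ≤ C * (1 / δ) ^ p * schwartzNorm M₀ f₁ * schwartzNorm M₀ f₂ * schwartzNorm M₀ g) := by
  sorry

/-- **Stub C `stub_threeSlotRegularity` (pure analysis; Hörmander ALPDO I §8.1 made quantitative).**  Fix a Schwartz order
`M₀`.  There are `N₁, q, B₀` such that for every assignment of lattice directions `D k` to the three slots whose slot
vectors `t ⊗ 1_k` together with the diagonal translations `e_μ ⊗ 1_{[3]}` span `(ℝ⁴)³`, every configuration `x` and radius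
`ρ ∈ (0,1]` with `2ρ`-separated points, and every continuous functional `Λ` on `𝓢((ℝ⁴)³)` that is translation invariant on
`⁰𝒮` and obeys the pure-derivative slot bounds `‖Λ(f with slot k replaced by ∂_tᴺ f_k)‖ ≤ ∏ |fᵢ|_{M₀}` (`t ∈ D k`,
`N ≤ N₁`, `supp fᵢ ⊆ B(xᵢ, ρ)`): on `∏ B(xᵢ, ρ/2)` the functional is integration against a continuous kernel bounded by
`B₀ ρ^{-q} (1 + ‖x‖)^q`.  Proof: cut-offs `χᵢ` (`= 1` on `B(xᵢ,ρ/2)`, supported in `B(xᵢ,ρ)`); plane-wave values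
`Λ(⊗ e_{aᵢ}χᵢ)` decay like `|⟨a_k,t⟩|^{-N}` (slot bounds, `PlaneWaveTensorDecay` per slot) and like `|⟨Σaᵢ,u⟩|^{-N}`
(translation identity `Λ(∂_Uᴺψ) = 0`, `TranslationOrbitDerivative`); spanning ⇒ `(1+‖a‖)^{-13}` decay; `FourierDecayKernel`
on the flattened `EuclideanSpace ℝ (Fin 3 × Fin 4)` (`flattenCLE`). -/
theorem stub_threeSlotRegularity :
    ∀ M₀ : ℕ, ∃ (N₁ q : ℕ) (B₀ : ℝ), ∀ (D : Fin 3 → Finset E4),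
      (∀ k, ∀ t ∈ D k, (∃ n v : E4, ((∃ (μ ν : Fin 4) (s s' : ℝ), μ ≠ ν ∧ (s = 1 ∨ s = -1) ∧ (s' = 1 ∨ s' = -1) ∧
            n = s • (EuclideanSpace.single μ (1 : ℝ) : E4) ∧ v = s' • (EuclideanSpace.single ν (1 : ℝ) : E4)) ∨
          (∃ (μ ν : Fin 4) (s s' : ℝ), μ ≠ ν ∧ (s = 1 ∨ s = -1) ∧ (s' = 1 ∨ s' = -1) ∧
            n = (Real.sqrt 2)⁻¹ • (s • (EuclideanSpace.single μ (1 : ℝ) : E4) + s' • (EuclideanSpace.single ν (1 : ℝ) : E4)) ∧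
            v = (Real.sqrt 2)⁻¹ • (s • (EuclideanSpace.single μ (1 : ℝ) : E4) - s' • (EuclideanSpace.single ν (1 : ℝ) : E4)))) ∧ (t = n ∨ t = v))) →
      (⊤ ≤ Submodule.span ℝ ((⋃ k : Fin 3, (fun t : E4 => (Pi.single k t : Fin 3 → E4)) '' (D k : Set E4)) ∪
          Set.range (fun μ : Fin 4 => fun _ : Fin 3 => (EuclideanSpace.single μ (1 : ℝ) : E4)))) →
      ∀ (x : Fin 3 → E4) (ρ : ℝ), 0 < ρ → ρ ≤ 1 → (∀ i j, i ≠ j → 2 * ρ < dist (x i) (x j)) →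
      ∀ Λ : 𝓢((Fin 3 → E4), ℂ) →L[ℂ] ℂ,
        (∀ (a : E4) (F : 𝓢((Fin 3 → E4), ℂ)), IsOffDiagonal F → Λ (translateMulti a F) = Λ F) →
        (∀ (k : Fin 3), ∀ t ∈ D k, ∀ N : ℕ, N ≤ N₁ → ∀ f : Fin 3 → 𝓢(E4, ℂ),
          (∀ i, tsupport (f i : E4 → ℂ) ⊆ Metric.ball (x i) ρ) → ∀ F : 𝓢((Fin 3 → E4), ℂ),
            IsTensorOf F (Function.update f k ((LineDeriv.lineDerivOp t : 𝓢(E4, ℂ) → 𝓢(E4, ℂ))^[N] (f k))) →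
              ‖Λ F‖ ≤ ∏ i, schwartzNorm M₀ (f i)) →
        ∃ K₃ : (Fin 3 → E4) → ℂ, ContinuousOn K₃ {y | ∀ i, y i ∈ Metric.ball (x i) (ρ / 2)} ∧
          (∀ y : Fin 3 → E4, (∀ i, y i ∈ Metric.ball (x i) (ρ / 2)) → ‖K₃ y‖ ≤ B₀ * ρ⁻¹ ^ q * (1 + ‖x‖) ^ q) ∧
          ∀ F : 𝓢((Fin 3 → E4), ℂ), tsupport (F : (Fin 3 → E4) → ℂ) ⊆ {y | ∀ i, y i ∈ Metric.ball (x i) (ρ / 2)} →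
            Integrable (fun y => K₃ y * F y) ∧ Λ F = ∫ y, K₃ y * F y := by
  sorry

/-- **Stub D `stub_chartSelection` (pure geometry of the sixteen lattice mirrors).**  There is `c > 0` such that every
injective triple `y` has a scale `r` (at least the distance of some pair) and TWO distinct GOOD slots `k`: either `y_k` lies
`c·r` above an `e_μ`-SEPARATED pair in an oriented axis frame `±e_μ` (⇒ time direction + three cone axes), or there are four
linearly independent directions `t_j`, each the time direction `n` or the in-plane partner `v` of an oriented diagonal frame
in which `y_k` lies `c·r` above the other two points.  Proof: pick `θ` on the ladder `{8^{-i}/2}` with no normalised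
coordinate difference in `[θ/8, θ)`; if some coordinate has three `θ r`-separated values its extreme slots are good (axis);
otherwise classify coordinates by tie type B = {13|2}, C = {12|3}, D = {23|1}, Z; injectivity forces two of B, C, D
non-empty and C ≠ ∅ ⇒ slot 3 good, B ≠ ∅ ⇒ slot 2 good, D ≠ ∅ ⇒ slot 1 good (diagonals `e_μ ± e_ν` over the type pairs;
the partner direction covers the one-sign cases). -/
theorem stub_chartSelection :
    ∃ c : ℝ, 0 < c ∧ ∀ y : Fin 3 → E4, Function.Injective y →
      ∃ r : ℝ, 0 < r ∧ (∃ i j, i ≠ j ∧ dist (y i) (y j) ≤ r) ∧ ∃ k₁ k₂ : Fin 3, k₁ ≠ k₂ ∧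
          ((∃ (μ : Fin 4) (s : ℝ), (s = 1 ∨ s = -1) ∧
              (∀ i, i ≠ k₁ → inner ℝ (y i) (s • (EuclideanSpace.single μ (1 : ℝ) : E4)) + c * r ≤
                inner ℝ (y k₁) (s • (EuclideanSpace.single μ (1 : ℝ) : E4))) ∧
              (∀ i i', i ≠ k₁ → i' ≠ k₁ → i ≠ i' →
                c * r ≤ |inner ℝ (y i) (EuclideanSpace.single μ (1 : ℝ) : E4) - inner ℝ (y i') (EuclideanSpace.single μ (1 : ℝ) : E4)|)) ∨
            (∃ t : Fin 4 → E4, LinearIndependent ℝ t ∧ ∀ j, ∃ n v : E4, (∃ (μ ν : Fin 4) (s s' : ℝ), μ ≠ ν ∧ (s = 1 ∨ s = -1) ∧ (s' = 1 ∨ s' = -1) ∧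
            n = (Real.sqrt 2)⁻¹ • (s • (EuclideanSpace.single μ (1 : ℝ) : E4) + s' • (EuclideanSpace.single ν (1 : ℝ) : E4)) ∧
            v = (Real.sqrt 2)⁻¹ • (s • (EuclideanSpace.single μ (1 : ℝ) : E4) - s' • (EuclideanSpace.single ν (1 : ℝ) : E4))) ∧ (t j = n ∨ t j = v) ∧
              ∀ i, i ≠ k₁ → inner ℝ (y i) n + c * r ≤ inner ℝ (y k₁) n)) ∧
          ((∃ (μ : Fin 4) (s : ℝ), (s = 1 ∨ s = -1) ∧
              (∀ i, i ≠ k₂ → inner ℝ (y i) (s • (EuclideanSpace.single μ (1 : ℝ) : E4)) + c * r ≤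
                inner ℝ (y k₂) (s • (EuclideanSpace.single μ (1 : ℝ) : E4))) ∧
              (∀ i i', i ≠ k₂ → i' ≠ k₂ → i ≠ i' →
                c * r ≤ |inner ℝ (y i) (EuclideanSpace.single μ (1 : ℝ) : E4) - inner ℝ (y i') (EuclideanSpace.single μ (1 : ℝ) : E4)|)) ∨
            (∃ t : Fin 4 → E4, LinearIndependent ℝ t ∧ ∀ j, ∃ n v : E4, (∃ (μ ν : Fin 4) (s s' : ℝ), μ ≠ ν ∧ (s = 1 ∨ s = -1) ∧ (s' = 1 ∨ s' = -1) ∧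
            n = (Real.sqrt 2)⁻¹ • (s • (EuclideanSpace.single μ (1 : ℝ) : E4) + s' • (EuclideanSpace.single ν (1 : ℝ) : E4)) ∧
            v = (Real.sqrt 2)⁻¹ • (s • (EuclideanSpace.single μ (1 : ℝ) : E4) - s' • (EuclideanSpace.single ν (1 : ℝ) : E4))) ∧ (t j = n ∨ t j = v) ∧
              ∀ i, i ≠ k₂ → inner ℝ (y i) n + c * r ≤ inner ℝ (y k₂) n)) := by
  sorry

/-- **Stub E `stub_threePointKernel` (assembly; takes the STATEMENTS of stubs B, C, D as hypotheses).**  For a family with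
the OS package, translations, proper signed permutations, eight frames, cone and diagonal product RP: a kernel `K₃`,
continuous on the injective locus of `(ℝ⁴)³`, with `|K₃(y)| ≤ C (1+‖y‖)ᴺ (1 + Σᵢ Σ_{j≠i} ‖yᵢ−yⱼ‖⁻¹)ᴺ`, representing `𝔖₃`
on compactly supported test functions supported in the injective locus.  Proof: at `y`, stub D gives two good slots with
gaps `≥ c r_min`; with `ρ = c r_min / 8` the chart bounds of stub B (slot order adjusted by E3, constants `C δ⁻ᵖ`,
`δ = c r_min/2 ∧ 1`) are the slot bounds of stub C for `Λ = 𝔖₃ / (C δ⁻ᵖ)`, whose spanning hypothesis is the goodness of the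
two slots; the local kernels (bound `C δ⁻ᵖ B₀ ρ^{-q}(1+‖y‖)^q ≤` the weight) agree on overlaps (du Bois-Reymond) and patch
(`integral_rep_of_local`, three-slot copy). -/
theorem stub_threePointKernel :
    (∀ (S₁ : SchwingerFamily E4), OSPackage S₁ → Translations S₁ → Hypercubic S₁ → EightFrameRP S₁ → PlanarCone S₁ →
      (∃ M₀ : ℕ, ∀ N : ℕ, ∃ (C : ℝ) (p : ℕ), ∀ (n v : E4),
          ((∃ (μ ν : Fin 4) (s s' : ℝ), μ ≠ ν ∧ (s = 1 ∨ s = -1) ∧ (s' = 1 ∨ s' = -1) ∧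
            n = s • (EuclideanSpace.single μ (1 : ℝ) : E4) ∧ v = s' • (EuclideanSpace.single ν (1 : ℝ) : E4)) ∨
          (∃ (μ ν : Fin 4) (s s' : ℝ), μ ≠ ν ∧ (s = 1 ∨ s = -1) ∧ (s' = 1 ∨ s' = -1) ∧
            n = (Real.sqrt 2)⁻¹ • (s • (EuclideanSpace.single μ (1 : ℝ) : E4) + s' • (EuclideanSpace.single ν (1 : ℝ) : E4)) ∧
            v = (Real.sqrt 2)⁻¹ • (s • (EuclideanSpace.single μ (1 : ℝ) : E4) - s' • (EuclideanSpace.single ν (1 : ℝ) : E4)))) →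
          ∀ δ : ℝ, 0 < δ → δ ≤ 1 → ∀ (c : ℝ) (f₁ f₂ g : 𝓢(E4, ℂ)),
            HasCompactSupport (f₁ : E4 → ℂ) → HasCompactSupport (f₂ : E4 → ℂ) → HasCompactSupport (g : E4 → ℂ) →
            tsupport (f₁ : E4 → ℂ) ⊆ {x : E4 | inner ℝ x n < c} → tsupport (f₂ : E4 → ℂ) ⊆ {x : E4 | inner ℝ x n < c} →
            tsupport (g : E4 → ℂ) ⊆ {x : E4 | c + δ < inner ℝ x n} →
            (∃ c' : ℝ, (tsupport (f₁ : E4 → ℂ) ⊆ {x : E4 | inner ℝ x n < c'} ∧ tsupport (f₂ : E4 → ℂ) ⊆ {x : E4 | c' < inner ℝ x n}) ∨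
              (tsupport (f₂ : E4 → ℂ) ⊆ {x : E4 | inner ℝ x n < c'} ∧ tsupport (f₁ : E4 → ℂ) ⊆ {x : E4 | c' < inner ℝ x n})) →
            ∀ w : E4, (w = n ∨ w = v) → ∀ F : 𝓢((Fin 3 → E4), ℂ),
              IsTensorOf F ![f₁, f₂, ((LineDeriv.lineDerivOp w : 𝓢(E4, ℂ) → 𝓢(E4, ℂ))^[N] g)] →
                ‖S₁ 3 F‖ ≤ C * (1 / δ) ^ p * schwartzNorm M₀ f₁ * schwartzNorm M₀ f₂ * schwartzNorm M₀ g) ∧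
      ((∀ (R : E4 ≃ₗᵢ[ℝ] E4) (a b : ℝ), a ^ 2 = 1 / 2 → b ^ 2 = 1 / 2 →
        R (EuclideanSpace.single (0 : Fin 4) (1 : ℝ)) = a • EuclideanSpace.single (0 : Fin 4) (1 : ℝ) + b • EuclideanSpace.single (1 : Fin 4) (1 : ℝ) →
        (∀ (N : ℕ) (deg : Fin N → ℕ) (g : (j : Fin N) → Fin (deg j) → 𝓢(E4, ℂ))
          (F : (j : Fin N) → 𝓢((Fin (deg j) → E4), ℂ)),
          (∀ j, IsTensorOf (F j) (g j)) →
          (∀ j i, HasCompactSupport (g j i : E4 → ℂ) ∧ tsupport (g j i : E4 → ℂ) ⊆ {x : E4 | 0 < x 0}) →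
          (∀ j i i', i ≠ i' → Disjoint (tsupport (g j i : E4 → ℂ)) (tsupport (g j i' : E4 → ℂ))) →
          ∀ H : (i j : Fin N) → 𝓢((Fin (deg i + deg j) → E4), ℂ),
            (∀ i j, IsAppendTensorOf (H i j) (osAdjoint (F i)) (F j)) →
              0 ≤ (∑ i, ∑ j, (fun m => (S₁ m).comp (linActMulti R)) (deg i + deg j) (H i j)).re ∧ (∑ i, ∑ j, (fun m => (S₁ m).comp (linActMulti R)) (deg i + deg j) (H i j)).im = 0)) →
        ∃ M₀ : ℕ, ∀ N : ℕ, ∃ (C : ℝ) (p : ℕ), ∀ (n v : E4),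
          (∃ (μ ν : Fin 4) (s s' : ℝ), μ ≠ ν ∧ (s = 1 ∨ s = -1) ∧ (s' = 1 ∨ s' = -1) ∧
            n = (Real.sqrt 2)⁻¹ • (s • (EuclideanSpace.single μ (1 : ℝ) : E4) + s' • (EuclideanSpace.single ν (1 : ℝ) : E4)) ∧
            v = (Real.sqrt 2)⁻¹ • (s • (EuclideanSpace.single μ (1 : ℝ) : E4) - s' • (EuclideanSpace.single ν (1 : ℝ) : E4))) →
          ∀ δ : ℝ, 0 < δ → δ ≤ 1 → ∀ (c : ℝ) (f₁ f₂ g : 𝓢(E4, ℂ)),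
            HasCompactSupport (f₁ : E4 → ℂ) → HasCompactSupport (f₂ : E4 → ℂ) → HasCompactSupport (g : E4 → ℂ) →
            tsupport (f₁ : E4 → ℂ) ⊆ {x : E4 | inner ℝ x n < c} → tsupport (f₂ : E4 → ℂ) ⊆ {x : E4 | inner ℝ x n < c} →
            tsupport (g : E4 → ℂ) ⊆ {x : E4 | c + δ < inner ℝ x n} →
            Disjoint (tsupport (f₁ : E4 → ℂ)) (tsupport (f₂ : E4 → ℂ)) →
            ∀ w : E4, (w = n ∨ w = v) → ∀ F : 𝓢((Fin 3 → E4), ℂ),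
              IsTensorOf F ![f₁, f₂, ((LineDeriv.lineDerivOp w : 𝓢(E4, ℂ) → 𝓢(E4, ℂ))^[N] g)] →
                ‖S₁ 3 F‖ ≤ C * (1 / δ) ^ p * schwartzNorm M₀ f₁ * schwartzNorm M₀ f₂ * schwartzNorm M₀ g)) →
    (∀ M₀ : ℕ, ∃ (N₁ q : ℕ) (B₀ : ℝ), ∀ (D : Fin 3 → Finset E4),
      (∀ k, ∀ t ∈ D k, (∃ n v : E4, ((∃ (μ ν : Fin 4) (s s' : ℝ), μ ≠ ν ∧ (s = 1 ∨ s = -1) ∧ (s' = 1 ∨ s' = -1) ∧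
            n = s • (EuclideanSpace.single μ (1 : ℝ) : E4) ∧ v = s' • (EuclideanSpace.single ν (1 : ℝ) : E4)) ∨
          (∃ (μ ν : Fin 4) (s s' : ℝ), μ ≠ ν ∧ (s = 1 ∨ s = -1) ∧ (s' = 1 ∨ s' = -1) ∧
            n = (Real.sqrt 2)⁻¹ • (s • (EuclideanSpace.single μ (1 : ℝ) : E4) + s' • (EuclideanSpace.single ν (1 : ℝ) : E4)) ∧
            v = (Real.sqrt 2)⁻¹ • (s • (EuclideanSpace.single μ (1 : ℝ) : E4) - s' • (EuclideanSpace.single ν (1 : ℝ) : E4)))) ∧ (t = n ∨ t = v))) →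
      (⊤ ≤ Submodule.span ℝ ((⋃ k : Fin 3, (fun t : E4 => (Pi.single k t : Fin 3 → E4)) '' (D k : Set E4)) ∪
          Set.range (fun μ : Fin 4 => fun _ : Fin 3 => (EuclideanSpace.single μ (1 : ℝ) : E4)))) →
      ∀ (x : Fin 3 → E4) (ρ : ℝ), 0 < ρ → ρ ≤ 1 → (∀ i j, i ≠ j → 2 * ρ < dist (x i) (x j)) →
      ∀ Λ : 𝓢((Fin 3 → E4), ℂ) →L[ℂ] ℂ,
        (∀ (a : E4) (F : 𝓢((Fin 3 → E4), ℂ)), IsOffDiagonal F → Λ (translateMulti a F) = Λ F) →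
        (∀ (k : Fin 3), ∀ t ∈ D k, ∀ N : ℕ, N ≤ N₁ → ∀ f : Fin 3 → 𝓢(E4, ℂ),
          (∀ i, tsupport (f i : E4 → ℂ) ⊆ Metric.ball (x i) ρ) → ∀ F : 𝓢((Fin 3 → E4), ℂ),
            IsTensorOf F (Function.update f k ((LineDeriv.lineDerivOp t : 𝓢(E4, ℂ) → 𝓢(E4, ℂ))^[N] (f k))) →
              ‖Λ F‖ ≤ ∏ i, schwartzNorm M₀ (f i)) →
        ∃ K₃ : (Fin 3 → E4) → ℂ, ContinuousOn K₃ {y | ∀ i, y i ∈ Metric.ball (x i) (ρ / 2)} ∧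
          (∀ y : Fin 3 → E4, (∀ i, y i ∈ Metric.ball (x i) (ρ / 2)) → ‖K₃ y‖ ≤ B₀ * ρ⁻¹ ^ q * (1 + ‖x‖) ^ q) ∧
          ∀ F : 𝓢((Fin 3 → E4), ℂ), tsupport (F : (Fin 3 → E4) → ℂ) ⊆ {y | ∀ i, y i ∈ Metric.ball (x i) (ρ / 2)} →
            Integrable (fun y => K₃ y * F y) ∧ Λ F = ∫ y, K₃ y * F y) →
    (∃ c : ℝ, 0 < c ∧ ∀ y : Fin 3 → E4, Function.Injective y →
      ∃ r : ℝ, 0 < r ∧ (∃ i j, i ≠ j ∧ dist (y i) (y j) ≤ r) ∧ ∃ k₁ k₂ : Fin 3, k₁ ≠ k₂ ∧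
          ((∃ (μ : Fin 4) (s : ℝ), (s = 1 ∨ s = -1) ∧
              (∀ i, i ≠ k₁ → inner ℝ (y i) (s • (EuclideanSpace.single μ (1 : ℝ) : E4)) + c * r ≤
                inner ℝ (y k₁) (s • (EuclideanSpace.single μ (1 : ℝ) : E4))) ∧
              (∀ i i', i ≠ k₁ → i' ≠ k₁ → i ≠ i' →
                c * r ≤ |inner ℝ (y i) (EuclideanSpace.single μ (1 : ℝ) : E4) - inner ℝ (y i') (EuclideanSpace.single μ (1 : ℝ) : E4)|)) ∨
            (∃ t : Fin 4 → E4, LinearIndependent ℝ t ∧ ∀ j, ∃ n v : E4, (∃ (μ ν : Fin 4) (s s' : ℝ), μ ≠ ν ∧ (s = 1 ∨ s = -1) ∧ (s' = 1 ∨ s' = -1) ∧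
            n = (Real.sqrt 2)⁻¹ • (s • (EuclideanSpace.single μ (1 : ℝ) : E4) + s' • (EuclideanSpace.single ν (1 : ℝ) : E4)) ∧
            v = (Real.sqrt 2)⁻¹ • (s • (EuclideanSpace.single μ (1 : ℝ) : E4) - s' • (EuclideanSpace.single ν (1 : ℝ) : E4))) ∧ (t j = n ∨ t j = v) ∧
              ∀ i, i ≠ k₁ → inner ℝ (y i) n + c * r ≤ inner ℝ (y k₁) n)) ∧
          ((∃ (μ : Fin 4) (s : ℝ), (s = 1 ∨ s = -1) ∧
              (∀ i, i ≠ k₂ → inner ℝ (y i) (s • (EuclideanSpace.single μ (1 : ℝ) : E4)) + c * r ≤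
                inner ℝ (y k₂) (s • (EuclideanSpace.single μ (1 : ℝ) : E4))) ∧
              (∀ i i', i ≠ k₂ → i' ≠ k₂ → i ≠ i' →
                c * r ≤ |inner ℝ (y i) (EuclideanSpace.single μ (1 : ℝ) : E4) - inner ℝ (y i') (EuclideanSpace.single μ (1 : ℝ) : E4)|)) ∨
            (∃ t : Fin 4 → E4, LinearIndependent ℝ t ∧ ∀ j, ∃ n v : E4, (∃ (μ ν : Fin 4) (s s' : ℝ), μ ≠ ν ∧ (s = 1 ∨ s = -1) ∧ (s' = 1 ∨ s' = -1) ∧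
            n = (Real.sqrt 2)⁻¹ • (s • (EuclideanSpace.single μ (1 : ℝ) : E4) + s' • (EuclideanSpace.single ν (1 : ℝ) : E4)) ∧
            v = (Real.sqrt 2)⁻¹ • (s • (EuclideanSpace.single μ (1 : ℝ) : E4) - s' • (EuclideanSpace.single ν (1 : ℝ) : E4))) ∧ (t j = n ∨ t j = v) ∧
              ∀ i, i ≠ k₂ → inner ℝ (y i) n + c * r ≤ inner ℝ (y k₂) n))) →
    ∀ (S₁ : SchwingerFamily E4), OSPackage S₁ → Translations S₁ → Hypercubic S₁ → EightFrameRP S₁ → PlanarCone S₁ →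
      (∀ (R : E4 ≃ₗᵢ[ℝ] E4) (a b : ℝ), a ^ 2 = 1 / 2 → b ^ 2 = 1 / 2 →
        R (EuclideanSpace.single (0 : Fin 4) (1 : ℝ)) = a • EuclideanSpace.single (0 : Fin 4) (1 : ℝ) + b • EuclideanSpace.single (1 : Fin 4) (1 : ℝ) →
        (∀ (N : ℕ) (deg : Fin N → ℕ) (g : (j : Fin N) → Fin (deg j) → 𝓢(E4, ℂ))
          (F : (j : Fin N) → 𝓢((Fin (deg j) → E4), ℂ)),
          (∀ j, IsTensorOf (F j) (g j)) →
          (∀ j i, HasCompactSupport (g j i : E4 → ℂ) ∧ tsupport (g j i : E4 → ℂ) ⊆ {x : E4 | 0 < x 0}) →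
          (∀ j i i', i ≠ i' → Disjoint (tsupport (g j i : E4 → ℂ)) (tsupport (g j i' : E4 → ℂ))) →
          ∀ H : (i j : Fin N) → 𝓢((Fin (deg i + deg j) → E4), ℂ),
            (∀ i j, IsAppendTensorOf (H i j) (osAdjoint (F i)) (F j)) →
              0 ≤ (∑ i, ∑ j, (fun m => (S₁ m).comp (linActMulti R)) (deg i + deg j) (H i j)).re ∧ (∑ i, ∑ j, (fun m => (S₁ m).comp (linActMulti R)) (deg i + deg j) (H i j)).im = 0)) →
        ∃ (K₃ : (Fin 3 → E4) → ℂ) (C : ℝ) (N : ℕ), 0 < C ∧ ContinuousOn K₃ {y | Function.Injective y} ∧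
          (∀ y : Fin 3 → E4, Function.Injective y →
            ‖K₃ y‖ ≤ C * (1 + ‖y‖) ^ N * (1 + ∑ i, ∑ j ∈ Finset.univ.erase i, ‖y i - y j‖⁻¹) ^ N) ∧
          ∀ F : 𝓢((Fin 3 → E4), ℂ), HasCompactSupport (F : (Fin 3 → E4) → ℂ) →
            tsupport (F : (Fin 3 → E4) → ℂ) ⊆ {y | Function.Injective y} →
              Integrable (fun y => K₃ y * F y) ∧ S₁ 3 F = ∫ y, K₃ y * F y := by
  sorry

/-- **Stub F `stub_degreeThreeOfKernel` (pure analysis + landed lemmas).**  A family whose three-point function is, on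
compactly supported test functions supported in the injective locus, integration against a continuous kernel dominated by
T's weight, and whose values on real off-diagonal tensors are real, has tempered tied lattice approximants in degree 3 along
every admissible `(a, L)`.  Proof: three-diagonal cut-off approximants `Φⱼ = θⱼ F → F` in `𝓢` for `F ∈ ⁰𝒮₃` (as
`OffDiagonalExtension.exists_cutoff_approx`), dominated convergence with the majorant `‖F‖·w` (flat decay of `⁰𝒮` functions
against the weight, `DominatedTieLimit.norm_mul_weight_le`, `integrable_piMajorant`) ⇒ representation and
`‖𝔖₃ F‖ ≤ ∫ ‖F‖ w` on `⁰𝒮₃`; then `temperedApproximants_of_dominated` (p164918) with `n = 3`. -/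
theorem stub_degreeThreeOfKernel :
    ∀ (S₁ : SchwingerFamily E4), (∃ (K₃ : (Fin 3 → E4) → ℂ) (C : ℝ) (N : ℕ), 0 < C ∧ ContinuousOn K₃ {y | Function.Injective y} ∧
          (∀ y : Fin 3 → E4, Function.Injective y →
            ‖K₃ y‖ ≤ C * (1 + ‖y‖) ^ N * (1 + ∑ i, ∑ j ∈ Finset.univ.erase i, ‖y i - y j‖⁻¹) ^ N) ∧
          ∀ F : 𝓢((Fin 3 → E4), ℂ), HasCompactSupport (F : (Fin 3 → E4) → ℂ) →
            tsupport (F : (Fin 3 → E4) → ℂ) ⊆ {y | Function.Injective y} →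
              Integrable (fun y => K₃ y * F y) ∧ S₁ 3 F = ∫ y, K₃ y * F y) →
      (∀ (f : Fin 3 → 𝓢(E4, ℝ)) (F : 𝓢((Fin 3 → E4), ℂ)),
        IsTensorOf F (fun i => ofRealTest (f i)) → IsOffDiagonal F → (S₁ 3 F).im = 0) →
      ∀ (a : ℕ → ℝ) (L : ℕ → ℕ), (∀ k, 0 < a k) → Tendsto a atTop (𝓝 0) →
        Tendsto (fun k => a k * L k) atTop atTop → TemperedApproximants a L S₁ 3 := by
  sorry

/-! ## Degrees `n ≥ 4` — the Yang–Mills content: CH_n along a subsequence -/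

/-- **Stub G `stub_shieldedMomentBoundSubseqFour` — CH_n along a subsequence, degrees `n ≥ 4` (the line's crux; held by the
lead).**  For every compact simple `G`, `r`, `sch`, `S₁` with `W1 r sch S₁`, the eight frames and the cone, and every
`n ≥ 4`: there are a strictly monotone `φ : ℕ → ℕ` and `C, p` such that for every physical radius `ρ ∈ (0,1]`, EVENTUALLY in
`k`, at every site `y` of the inner half-box of step `φ k` the `Lⁿ(μ_{φ k})`-norm of the shielded renormalised curvature
`E_{φ k}[c_{φ k}(F(τ_yŨ) − m_{φ k}) | links based outside the sup-cube of radius ⌊ρ/a_{φ k}⌋ around y]` is `≤ C ρ^{-p}`.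
(Reshape 3's `stub_shieldedMomentBoundSubseqHigh` with `3 ≤ n` replaced by `4 ≤ n`.)  Certified: the frequently-tame sector
(p163950).  Residual: eventually-wild schemes — the UV problem; from degree 4 on the junk family (p141448) shows that the
four-point lattice functions must enter quantitatively near rectangles. -/
theorem stub_shieldedMomentBoundSubseqFour :
    ∀ (G : Type) [Group G] [TopologicalSpace G] [IsTopologicalGroup G] [CompactSpace G]
      [MeasurableSpace G] [BorelSpace G], IsCompactSimpleLieGroup G →
      ∀ (r : LatticeRep G) (sch : SpeciesScheme (YMSpecies G)) (S₁ : SchwingerFamily E4),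
        W1 r sch S₁ → EightFrameRP S₁ → PlanarCone S₁ → ∀ n : ℕ, 4 ≤ n →
        ∃ φ : ℕ → ℕ, StrictMono φ ∧
        ∃ (C p : ℝ), 0 < C ∧ ∀ ρ : ℝ, 0 < ρ → ρ ≤ 1 → ∃ k₀ : ℕ, ∀ k : ℕ, k₀ ≤ k →
          ∀ y : Site 4, y ∈ box 4 (sch.L (φ k) / 2) →
            (∫ U, |((wilsonMeasure r.ρ (sch.β (φ k)) :
                Measure (GaugeConfig 4 (2 * sch.L (φ k) + 1) G))[(fun U =>
                sch.c r.curvature (φ k) *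
                  (r.curvature.F (configShift (-y) (torusLift (2 * sch.L (φ k) + 1) U)) -
                    sch.m r.curvature (φ k))) |
                cylinderEvents {ℓ : Edge 4 (2 * sch.L (φ k) + 1) | ¬ ∀ ν : Fin 4,
                  (ℓ.1 ν - ((y ν : ℤ) : ZMod (2 * sch.L (φ k) + 1)) +
                    ((⌊ρ / sch.a (φ k)⌋₊ : ℕ) : ZMod (2 * sch.L (φ k) + 1))).val ≤
                      2 * ⌊ρ / sch.a (φ k)⌋₊}]) U| ^ n
              ∂(wilsonMeasure r.ρ (sch.β (φ k)) : Measure (GaugeConfig 4 (2 * sch.L (φ k) + 1) G))) ^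
                ((n : ℝ)⁻¹) ≤ C * ρ ^ (-p) := by
  sorry

/-! ## Composition: the crux by name -/

/-- **T from the stubs** — `TemperedCurvatureMoments` BY NAME, by cases on the degree: `n = 1` is the landed
`DegreeOne.temperedCurvatureMoments_one`; `n = 2` is the landed `stub_degreeTwo` (realness of `S₁ 2` from the tie,
`im_apply_eq_zero_of_tie`); `n = 3`: diagonal product RP (stub A), the kernel of stub E from stubs B, C, D, realness from the
tie, and stub F; for `n ≥ 4`, stub G gives a subsequence `φ` with CH_n along `sch ∘ φ`; the reindexed scheme is tied to `S₁`
(`tie_reindex`, p163367), so the landed composition (C1–C3 ⇒ MESO, A3 witness, A2 over A1) gives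
`TemperedApproximants (a ∘ φ) (L ∘ φ) S₁ n`; A4 transfers it to `(a, L)`; `temperedCurvatureMoments_iff`. -/
theorem TemperedCurvatureMoments_of : TemperedCurvatureMoments := by
  rw [temperedCurvatureMoments_iff]
  intro G _ _ _ _ _ _ hG r sch S₁ hW h8 hC n hn
  rcases Nat.lt_or_ge n 4 with hlt | hge
  · -- degrees 1, 2 and 3
    interval_cases n
    · exact DegreeOne.temperedCurvatureMoments_one G hG r sch S₁ hW h8 hC
    · exact stub_degreeTwo S₁ hW.2.1 hW.2.2.1 hW.2.2.2.1 h8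
        (fun f F hF hF' => im_apply_eq_zero_of_tie r sch S₁ hW.1 two_pos f F hF hF')
        sch.a sch.L sch.a_pos sch.tendsto_a sch.tendsto_L
    · -- degree 3: diagonal product RP (A) ⇒ kernel (E over B, C, D) ⇒ approximants (F)
      have hPRP := stub_diagonalProductRP G hG r sch S₁ hW h8 hC
      have hK := stub_threePointKernel stub_threePointChartBounds stub_threeSlotRegularity stub_chartSelection
        S₁ hW.2.1 hW.2.2.1 hW.2.2.2.1 h8 hC hPRP
      exact stub_degreeThreeOfKernel S₁ hK
        (fun f F hF hF' => im_apply_eq_zero_of_tie r sch S₁ hW.1 three_pos f F hF hF')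
        sch.a sch.L sch.a_pos sch.tendsto_a sch.tendsto_L
  · -- degrees `n ≥ 4`: CH_n along a subsequence
    obtain ⟨φ, hφ, hCH⟩ := stub_shieldedMomentBoundSubseqFour G hG r sch S₁ hW h8 hC n hge
    -- the reindexed scheme `sch ∘ φ`
    let sch' : SpeciesScheme (YMSpecies G) :=
      { a := sch.a ∘ φ, a_pos := fun k => sch.a_pos (φ k), tendsto_a := sch.tendsto_a.comp hφ.tendsto_atTop,
        β := sch.β ∘ φ, L := sch.L ∘ φ, tendsto_L := sch.tendsto_L.comp hφ.tendsto_atTop,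
        c := fun s => sch.c s ∘ φ, m := fun s => sch.m s ∘ φ }
    have htie' : Tie r sch' S₁ := tie_reindex r sch S₁ hW.1 hφ
    -- (C)+(A) along the subsequence
    have hT' : TemperedApproximants sch'.a sch'.L S₁ n :=
      temperedApproximants_of_shieldedMomentBound r sch' S₁ htie' (by omega) hCH
    -- (A4) transfer back to `(sch.a, sch.L)`
    exact stub_approximantsTransfer n (by omega) S₁ sch.a sch'.a sch.L sch'.L sch.a_pos sch.tendsto_a sch.tendsto_L
      sch'.a_pos sch'.tendsto_a sch'.tendsto_L hT'

end Summit.QuantumFields.YangMills.Theorems.TemperedCurvatureMoments.Sketch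

end
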